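import Literature.NumberTheory.ComplexMultiplication.EllipticUnits.ThetaSingularValues
import Mathlib.Analysis.SpecialFunctions.Elliptic.Weierstrass
import Mathlib.Data.Finset.Card
import HarnessLib

/-!
# The permutation of a system of representatives of `𝔞⁻¹L/L` induced by multiplication by an element invertible modulo `𝔞`
# (de Shalit II §4.9 (ii): «the `x`-coordinates of `E[𝔞] ∖ O` are permuted by `Gal(K̄/K)`» — lattice bookkeeping; proofs only)

Topic `NumberTheory/ComplexMultiplication/EllipticUnits` (theorems only; no definition, no named fact, no instance).  Cell `bsd-print-cf2`, width
seat `bsd-line-cf2c-w4` g15.  For lattices `Λ ≤ Λ′` with a system of representatives `S` of `Λ′/Λ` (`PeriodPair.IsLatticeReps L L′ S`), both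
stable under `ι(𝒪_K)` (`IsCMLattice`), and `γ, δ ∈ 𝒪_K` with `γδ ≡ 1` on `Λ′/Λ` (`ι(γδ)x − x ∈ Λ` for `x ∈ Λ′`; e.g. `Λ′ = 𝔞⁻¹Λ`, `γδ − 1 ∈ 𝔞`):
the map `c ↦ rep(ι(γ)·c)` is a bijection of `S ∖ {0}`.  This is the permutation `e` (hypotheses `heT`, `hinj`, `hsurj`) of the theta
presentations `DeShalitThetaTExpansionIntegral.map_thetaTExpansion_of_perm`, `DeShalitThetaTExpansionColemanValues.…_of_semiconj`,
`DeShalitThetaTExpansionColemanBridge`, `KatzMeasureJZeroSeam.exists_unit_relColemanSeries_eq_subst_subst_of_thetaReadings`, for the inverse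
Frobenius `σ_v⁻¹` acting on the `𝔞`-division values `x_c = ℘(c) − b` through `c ↦ γc` (`γψ(v) ≡ 1 (mod 𝔞)`,
`GrossencharacterFrobeniusInverse.algClosureEmb_galFrob_symm_eq`), together with the value identity `hxτ`:

* `exists_rep`, `rep_unique` — representatives; `mul_notMem_of_notMem` (`ι(γ)c ∉ Λ` for `c ∈ Λ′ ∖ Λ`);
* ★ `exists_perm_of_mul_inv` — **a map `e : ℂ → ℂ` with `e c ∈ S ∖ 0`, `ι(γ)c − e c ∈ Λ` for `c ∈ S ∖ 0`, injective and surjective on `S ∖ 0`**;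
* ★ `apply_eq_of_readings` — **`τ(x_c) = x_{e c}`** on `S ∖ 0` when an injective reading `φ : R → ℂ` gives `φ(x_c) = ℘(c) − b` and
  `φ(τ x_c) = ℘(ι(γ)c) − b` (`℘` is `Λ`-periodic).

No summit statement is proved; BSD is not proved by any of this.

## References
* [deShalit1987] E. de Shalit, *Iwasawa theory of elliptic curves with complex multiplication* (1987), II §2.3 (10), II §4.9 (proof of (ii)).
-/

noncomputable section

open scoped Classical
open NumberField PeriodPair

namespace Literature.NumberTheory.ComplexMultiplication.EllipticUnits

variable {K : Type} [Field K] (ι : K →+* ℂ) {L La : PeriodPair} {S : Finset ℂ}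

/-- Every element of `Λ′` has a representative in `S`. [cite: deShalit1987, II §2.3 (10)] -/
theorem exists_rep (hS : L.IsLatticeReps La S) {x : ℂ} (hx : x ∈ La.lattice) : ∃ c ∈ S, x - c ∈ L.lattice :=
  (hS.mem_iff x).mp hx

/-- Representatives are unique. [cite: deShalit1987, II §2.3 (10)] -/
theorem rep_unique (hS : L.IsLatticeReps La S) {x c c' : ℂ} (hc : c ∈ S) (hc' : c' ∈ S) (h : x - c ∈ L.lattice)
    (h' : x - c' ∈ L.lattice) : c = c' :=
  hS.distinct c hc c' hc' (by have := L.lattice.sub_mem h' h; rwa [sub_sub_sub_cancel_left] at this)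

/-- Representatives lie in `Λ′`. [cite: deShalit1987, II §2.3 (10)] -/
theorem rep_mem (hS : L.IsLatticeReps La S) {c : ℂ} (hc : c ∈ S) : c ∈ La.lattice :=
  (hS.mem_iff c).mpr ⟨c, hc, by rw [sub_self]; exact L.lattice.zero_mem⟩

/-- **`ι(γ)c ∉ Λ` for `c ∈ Λ′ ∖ Λ`** when `γδ ≡ 1` on `Λ′/Λ` and `Λ` has `𝒪_K`-multiplication. [cite: deShalit1987, II §2.3] -/
theorem mul_notMem_of_notMem (hΛ : IsCMLattice ι L.lattice) {γ δ : 𝓞 K}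
    (hγδ : ∀ x ∈ La.lattice, ι ((γ * δ : 𝓞 K) : K) * x - x ∈ L.lattice) {c : ℂ} (hcLa : c ∈ La.lattice) (hc : c ∉ L.lattice) :
    ι (γ : K) * c ∉ L.lattice := by
  intro h
  apply hc
  have h1 := hΛ δ _ h
  have h2 := hγδ c hcLa
  have e : ι (δ : K) * (ι (γ : K) * c) = ι ((γ * δ : 𝓞 K) : K) * c := by push_cast; rw [map_mul]; ring
  rw [e] at h1
  have := L.lattice.sub_mem h1 h2
  rwa [sub_sub_cancel] at this

/-- ★ **The permutation of `S ∖ 0` induced by `c ↦ ι(γ)c`.**  For `Λ`, `Λ′` with `𝒪_K`-multiplication, representatives `S` of `Λ′/Λ`, and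
`γδ ≡ 1` on `Λ′/Λ`: there is `e : ℂ → ℂ` with `e c ∈ S ∖ 0` and `ι(γ)c − e c ∈ Λ` for `c ∈ S ∖ 0`, injective and surjective on `S ∖ 0`
— the data `(eι, heT, hinj, hsurj)` of the theta presentations. [cite: deShalit1987, II §4.9 (proof of (ii))] -/
theorem exists_perm_of_mul_inv (hS : L.IsLatticeReps La S) (hΛ : IsCMLattice ι L.lattice) (hΛa : IsCMLattice ι La.lattice) {γ δ : 𝓞 K}
    (hγδ : ∀ x ∈ La.lattice, ι ((γ * δ : 𝓞 K) : K) * x - x ∈ L.lattice) :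
    ∃ e : ℂ → ℂ, (∀ c ∈ S.erase 0, e c ∈ S.erase 0) ∧ (∀ c ∈ S.erase 0, ι (γ : K) * c - e c ∈ L.lattice) ∧
      Set.InjOn e (S.erase 0 : Finset ℂ) ∧ Set.SurjOn e (S.erase 0 : Finset ℂ) (S.erase 0 : Finset ℂ) := by
  -- the representative of `ι(γ)c`
  have hrep : ∀ c ∈ S, ∃ c' ∈ S, ι (γ : K) * c - c' ∈ L.lattice := fun c hc => exists_rep hS (hΛa γ c (rep_mem hS hc))
  choose! e he using hrep
  have hmem : ∀ c ∈ S.erase 0, e c ∈ S.erase 0 := by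
    intro c hc
    obtain ⟨hc0, hcS⟩ := Finset.mem_erase.mp hc
    refine Finset.mem_erase.mpr ⟨?_, (he c hcS).1⟩
    intro h0
    have h1 := (he c hcS).2
    rw [h0, sub_zero] at h1
    refine mul_notMem_of_notMem ι hΛ hγδ (rep_mem hS hcS) ?_ h1
    intro hcL
    exact hc0 (hS.distinct c hcS 0 hS.zero_mem (by rwa [sub_zero]))
  have hinj : Set.InjOn e (S.erase 0 : Finset ℂ) := by
    intro c hc c' hc' hcc
    have hcS := (Finset.mem_erase.mp (Finset.mem_coe.mp hc)).2
    have hc'S := (Finset.mem_erase.mp (Finset.mem_coe.mp hc')).2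
    have h1 := (he c hcS).2
    have h2 := (he c' hc'S).2
    rw [hcc] at h1
    -- `ι(γ)(c − c′) ∈ Λ`, multiply by `δ`
    have h3 : ι (γ : K) * (c - c') ∈ L.lattice := by
      have := L.lattice.sub_mem h1 h2; rw [mul_sub]; convert this using 1; ring
    have h4 := hΛ δ _ h3
    have h5 := hγδ (c - c') (La.lattice.sub_mem (rep_mem hS hcS) (rep_mem hS hc'S))
    have e6 : ι (δ : K) * (ι (γ : K) * (c - c')) = ι ((γ * δ : 𝓞 K) : K) * (c - c') := by push_cast; rw [map_mul]; ring
    rw [e6] at h4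
    have h7 := L.lattice.sub_mem h4 h5
    rw [sub_sub_cancel] at h7
    exact hS.distinct c hcS c' hc'S h7
  refine ⟨e, hmem, fun c hc => (he c (Finset.mem_erase.mp hc).2).2, hinj, ?_⟩
  exact Finset.surjOn_of_injOn_of_card_le e (fun c hc => Finset.mem_coe.mpr (hmem c (Finset.mem_coe.mp hc))) hinj le_rfl

/-- ★ **`τ(x_c) = x_{e c}` from readings**: if an injective `φ : R → ℂ` reads `x_c` as `℘(c) − b` on `S ∖ 0` and `τ x_c` as `℘(ι(γ)c) − b`, and
`ι(γ)c − e c ∈ Λ` with `e c ∈ S ∖ 0`, then `τ x_c = x_{e c}` (`℘` is `Λ`-periodic) — the hypothesis `hxτ` of the theta presentations.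
[cite: deShalit1987, II §4.9 (proof of (ii))] -/
theorem apply_eq_of_readings {R : Type*} (φ : R → ℂ) (hφ : Function.Injective φ) (τ : R → R) (x : ℂ → R) (b : ℂ) {γ : 𝓞 K}
    {e : ℂ → ℂ} (heS : ∀ c ∈ S.erase 0, e c ∈ S.erase 0) (he : ∀ c ∈ S.erase 0, ι (γ : K) * c - e c ∈ L.lattice)
    (hx : ∀ c ∈ S.erase 0, φ (x c) = ℘[L] c - b) (hτx : ∀ c ∈ S.erase 0, φ (τ (x c)) = ℘[L] (ι (γ : K) * c) - b) :
    ∀ c ∈ S.erase 0, τ (x c) = x (e c) := by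
  intro c hc
  apply hφ
  rw [hτx c hc, hx (e c) (heS c hc)]
  have e1 : ι (γ : K) * c = e c + ((⟨ι (γ : K) * c - e c, he c hc⟩ : L.lattice) : ℂ) := by
    change ι (γ : K) * c = e c + (ι (γ : K) * c - e c); ring
  rw [e1, L.weierstrassP_add_coe]

end Literature.NumberTheory.ComplexMultiplication.EllipticUnits

end
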